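import Mathlib
import HarnessLib
import Summits.Ventures.LatticeQCDFlow.Exactness.GroupMetropolisLinkErgodic
import Summits.Ventures.LatticeQCDFlow.Exactness.SU2ExpChartMinorisation
import Literature.MathematicalPhysics.QuantumLattice.GaugeGroupsProofs

/-!
# On `SU(2)` a kick law dominating Lebesgue-through-the-chart near the identity covers: the N-hit link Metropolis is Doeblin

HONEST FRAMING: exact (Metropolis-corrected) sampling algorithms for lattice gauge theory;
figures of merit are autocorrelation/cost numbers at stated couplings and volumes; no
continuum-physics claim.

Venture `LatticeQCDFlow` (cell pub-lqcd), topic `Exactness`, FANOUT row 9 (eng-latcore, the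
engine `latflow.core`: the `SU(2)` link Metropolis `U ← exp(X) U` of `updates.sweep_metropolis` /
`sun_2d.sweep_metropolis`, `X = iA·σ` with box-distributed coordinates `A`).  NEW WORK of the cell
over the tree (`ConnectedGroupKickCovering.lean`: the covering theorem in density form;
`GroupMetropolisLinkErgodic.lean`: Doeblin ⇒ uniform ergodicity for the N-hit link Metropolis;
`SU2ExpChartMinorisation.lean`: `sigmaSU2_norm_le`; Literature `GaugeGroupsProofs`: `SU(N)` is
connected).  The exponential chart of `SU(2)` is IMPORTED BY NAME from the literature formalisation
`Balaban1983to89.B10Eq18SigmaSU2Haar` (Bałaban, CMP 102 (1985) p. 260: `∫ F dU =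
∫_{|A|<π} F(exp iA·σ) σ(|A|) d³A`, `lintegral_haarProbability_eq_pauli`; Euler's formula
`exp_su2Coord`); nothing of it is re-proved and nothing here is cited as a fact.

* §1 `trace_su2Coord` (`tr(iA·σ) = 0`), **`trace_expPauli`** (`tr exp(iA·σ) = 2 cos|A|`).
* §2 the TRACE BUMP `su2TraceBump r U = max(0, Re tr U − 2 cos r)`: continuous, `≥ 0`, positive at
  `1` for `0 < r ≤ π`, and THROUGH THE CHART `= max(0, 2cos|A| − 2cos r) ≤ 4`, vanishing for
  `r ≤ |A| ≤ π` — a continuous function on the group supported in the chart window `{|A| < r}`,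
  built without a logarithm.
* §3 **`withDensity_su2TraceBump_le`** — `(su2TraceBump r) · Haar ≤ (4/2π²) • (d³A|_{|A|<r}) ∘ (exp i·σ)⁻¹`
  (the chart formula and `σ ≤ (2π²)⁻¹`).
* §4 **`su2Kick_nHit_minorised`** — ANY step law `ν` on `SU(2)` dominating
  `c • (d³A|_{|A|<r}) ∘ (exp i·σ)⁻¹` for some `0 < r ≤ π`, `c ≠ 0`, has some number `k` of kicks
  dominating `δ ·` Haar from every start (`δ > 0`); **`su2LinkMetropolis_uniformlyErgodic`** — so
  for an inversion-invariant probability step law of this kind and a measurable weight pinched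
  `0 < m ≤ p ≤ M`, the `k`-hit link Metropolis `symMH (mulWalk ν) p` converges to `Z⁻¹ p · Haar`
  geometrically in total variation from every initial law, and `Z⁻¹ p · Haar` is the only
  probability law invariant under one hit.

For the engine: the `SU(2)` proposal of `sweep_metropolis` at kick size `s` draws `A` with two
box-uniform coordinates and one triangular one, a law dominating `(4s)⁻¹(2s)⁻² ·` Lebesgue on the
ball `|A| < 3s/4 ∧ …` — the verification that it is of the kind above is `SU2MetropolisKickLaw.lean`.
NOT CLAIMED: any count of hits or rate; `SU(N ≥ 3)`.
-/

noncomputable section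

namespace Summit.Ventures.LatticeQCDFlow.Exactness

open MeasureTheory ProbabilityTheory Set Filter Topology Function Metric
open Literature.MathematicalPhysics.QuantumFieldTheory (haarProbability)
open Literature.MathematicalPhysics.QuantumLattice (connectedSpace_specialUnitaryGroup)
open Literature.MathematicalPhysics.QuantumFieldTheory.Balaban1983to89.B10Eq18SigmaSU2 (su2Coord)
open Literature.MathematicalPhysics.QuantumFieldTheory.Balaban1983to89.B10Eq22Rescaling (sigmaSU2)
open Literature.MathematicalPhysics.QuantumFieldTheory.Balaban1983to89.B10Eq18SigmaSU2Haar
  (expPauli coe_expPauli measurable_expPauli continuous_expPauli exp_su2Coord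
    lintegral_haarProbability_eq_pauli)
open scoped ENNReal

/-! ## §1 The trace of the chart -/

/-- `tr(iA·σ) = 0`. -/
theorem trace_su2Coord (x : Fin 3 → ℝ) : (su2Coord x).trace = 0 := by
  simp [su2Coord, Matrix.trace_fin_two]

/-- **`tr exp(iA·σ) = 2 cos|A|`** (Euler's formula in `SU(2)`, `exp_su2Coord`). -/
theorem trace_expPauli (A : EuclideanSpace ℝ (Fin 3)) :
    ((expPauli A : Matrix.specialUnitaryGroup (Fin 2) ℂ) : Matrix (Fin 2) (Fin 2) ℂ).trace =
      ((2 * Real.cos ‖A‖ : ℝ) : ℂ) := by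
  rw [coe_expPauli, exp_su2Coord, Matrix.trace_add, Matrix.trace_smul, Matrix.trace_smul,
    Matrix.trace_one, trace_su2Coord, smul_zero, add_zero, Fintype.card_fin, smul_eq_mul]
  push_cast
  ring

/-- `Re tr exp(iA·σ) = 2 cos|A|`. -/
theorem re_trace_expPauli (A : EuclideanSpace ℝ (Fin 3)) :
    (((expPauli A : Matrix.specialUnitaryGroup (Fin 2) ℂ) : Matrix (Fin 2) (Fin 2) ℂ).trace).re =
      2 * Real.cos ‖A‖ := by
  rw [trace_expPauli, Complex.ofReal_re]

/-! ## §2 The trace bump: a continuous function on the group living in a chart window -/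

/-- The trace bump of radius `r`: `U ↦ max(0, Re tr U − 2 cos r)`. -/
def su2TraceBump (r : ℝ) (U : Matrix.specialUnitaryGroup (Fin 2) ℂ) : ℝ :=
  max 0 (((U : Matrix (Fin 2) (Fin 2) ℂ).trace).re - 2 * Real.cos r)

/-- The trace bump is continuous. -/
theorem continuous_su2TraceBump (r : ℝ) : Continuous (su2TraceBump r) :=
  continuous_const.max ((Complex.continuous_re.comp (continuous_subtype_val.matrix_trace)).sub
    continuous_const)

/-- The trace bump is non-negative. -/
theorem su2TraceBump_nonneg (r : ℝ) (U : Matrix.specialUnitaryGroup (Fin 2) ℂ) : 0 ≤ su2TraceBump r U :=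
  le_max_left _ _

/-- The trace bump is positive at the identity for `0 < r ≤ π` (`tr 1 = 2 > 2 cos r`). -/
theorem su2TraceBump_one_pos {r : ℝ} (hr0 : 0 < r) (hrπ : r ≤ Real.pi) : 0 < su2TraceBump r 1 := by
  have hcos : Real.cos r < 1 := by
    rw [← Real.cos_zero]
    exact Real.cos_lt_cos_of_nonneg_of_le_pi le_rfl hrπ hr0
  have htr : (((1 : Matrix.specialUnitaryGroup (Fin 2) ℂ) : Matrix (Fin 2) (Fin 2) ℂ).trace).re = 2 := by
    simp
  unfold su2TraceBump
  rw [htr]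
  exact lt_max_of_lt_right (by linarith)

/-- **Through the chart**: `su2TraceBump r (exp iA·σ) = max(0, 2cos|A| − 2cos r)`. -/
theorem su2TraceBump_expPauli (r : ℝ) (A : EuclideanSpace ℝ (Fin 3)) :
    su2TraceBump r (expPauli A) = max 0 (2 * Real.cos ‖A‖ - 2 * Real.cos r) := by
  rw [su2TraceBump, re_trace_expPauli]

/-- … hence `≤ 4` there, -/
theorem su2TraceBump_expPauli_le (r : ℝ) (A : EuclideanSpace ℝ (Fin 3)) : su2TraceBump r (expPauli A) ≤ 4 := by
  rw [su2TraceBump_expPauli]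
  exact max_le (by norm_num) (by linarith [Real.cos_le_one ‖A‖, Real.neg_one_le_cos r])

/-- … and `= 0` outside the window: `r ≤ |A| ≤ π` (`cos` decreases on `[0, π]`). -/
theorem su2TraceBump_expPauli_eq_zero {r : ℝ} (hr0 : 0 ≤ r) {A : EuclideanSpace ℝ (Fin 3)}
    (hrA : r ≤ ‖A‖) (hAπ : ‖A‖ ≤ Real.pi) : su2TraceBump r (expPauli A) = 0 := by
  rw [su2TraceBump_expPauli]
  exact max_eq_left (by linarith [Real.cos_le_cos_of_nonneg_of_le_pi hr0 hAπ hrA])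

/-! ## §3 The trace bump times Haar is dominated by Lebesgue on the window, through the chart -/

/-- **`(su2TraceBump r) · Haar ≤ (4/2π²) • (d³A|_{|A|<r}) ∘ (exp i·σ)⁻¹`** for `0 < r`. -/
theorem withDensity_su2TraceBump_le {r : ℝ} (hr0 : 0 < r) :
    (haarProbability (Matrix.specialUnitaryGroup (Fin 2) ℂ)).withDensity
        (fun U => ENNReal.ofReal (su2TraceBump r U)) ≤
      ENNReal.ofReal (4 * (2 * Real.pi ^ 2)⁻¹) •
        (volume.restrict (ball (0 : EuclideanSpace ℝ (Fin 3)) r)).map expPauli := by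
  set C : ℝ≥0∞ := ENNReal.ofReal (4 * (2 * Real.pi ^ 2)⁻¹) with hC
  refine Measure.le_iff.2 fun s hs => ?_
  have hφm : Measurable fun U : Matrix.specialUnitaryGroup (Fin 2) ℂ => ENNReal.ofReal (su2TraceBump r U) :=
    (continuous_su2TraceBump r).measurable.ennreal_ofReal
  have hW : MeasurableSet (expPauli ⁻¹' s ∩ ball (0 : EuclideanSpace ℝ (Fin 3)) r) :=
    (measurable_expPauli hs).inter measurableSet_ball
  rw [withDensity_apply _ hs, ← lintegral_indicator hs, lintegral_haarProbability_eq_pauli _ (hφm.indicator hs),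
    Measure.smul_apply, smul_eq_mul, Measure.map_apply measurable_expPauli hs,
    Measure.restrict_apply (measurable_expPauli hs), ← lintegral_indicator_one hW,
    ← lintegral_const_mul _ (measurable_one.indicator hW)]
  calc ∫⁻ A in ball (0 : EuclideanSpace ℝ (Fin 3)) Real.pi,
        s.indicator (fun U => ENNReal.ofReal (su2TraceBump r U)) (expPauli A) * ENNReal.ofReal (sigmaSU2 ‖A‖)
      ≤ ∫⁻ A in ball (0 : EuclideanSpace ℝ (Fin 3)) Real.pi,
          C * (expPauli ⁻¹' s ∩ ball (0 : EuclideanSpace ℝ (Fin 3)) r).indicator 1 A := by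
        refine setLIntegral_mono' measurableSet_ball fun A hA => ?_
        rw [mem_ball_zero_iff] at hA
        by_cases hs' : expPauli A ∈ s
        · rw [indicator_of_mem hs']
          by_cases hr : ‖A‖ < r
          · rw [indicator_of_mem (show A ∈ expPauli ⁻¹' s ∩ ball (0 : EuclideanSpace ℝ (Fin 3)) r from
                ⟨hs', mem_ball_zero_iff.2 hr⟩), Pi.one_apply, mul_one, hC,
              ENNReal.ofReal_mul (by norm_num : (0 : ℝ) ≤ 4)]
            exact mul_le_mul' (ENNReal.ofReal_le_ofReal (su2TraceBump_expPauli_le r A))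
              (ENNReal.ofReal_le_ofReal (sigmaSU2_norm_le A))
          · rw [su2TraceBump_expPauli_eq_zero hr0.le (not_lt.1 hr) hA.le, ENNReal.ofReal_zero, zero_mul]
            exact bot_le
        · rw [indicator_of_notMem hs', zero_mul]
          exact bot_le
    _ ≤ ∫⁻ A, C * (expPauli ⁻¹' s ∩ ball (0 : EuclideanSpace ℝ (Fin 3)) r).indicator 1 A :=
        lintegral_mono' Measure.restrict_le_self le_rfl

/-! ## §4 Covering and the N-hit link Metropolis on `SU(2)` -/

/-- **ON `SU(2)`, A STEP LAW DOMINATING LEBESGUE-THROUGH-THE-CHART NEAR `1` COVERS**: if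
`ν ≥ c • (d³A|_{|A|<r}) ∘ (exp i·σ)⁻¹` for some `0 < r ≤ π`, `c ≠ 0`, then some number `k` of
`ν`-kicks dominates `δ ·` Haar from EVERY start, `δ > 0`. -/
theorem su2Kick_nHit_minorised {ν : Measure (Matrix.specialUnitaryGroup (Fin 2) ℂ)} [SFinite ν] {r : ℝ}
    (hr0 : 0 < r) (hrπ : r ≤ Real.pi) {c : ℝ≥0∞} (hc : c ≠ 0)
    (hν : c • (volume.restrict (ball (0 : EuclideanSpace ℝ (Fin 3)) r)).map expPauli ≤ ν) :
    ∃ k : ℕ, ∃ δ : ℝ≥0∞, 0 < δ ∧ ∀ u : Matrix.specialUnitaryGroup (Fin 2) ℂ,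
      δ • haarProbability (Matrix.specialUnitaryGroup (Fin 2) ℂ) ≤ nHit (mulWalk ν) k u := by
  haveI : ConnectedSpace (Matrix.specialUnitaryGroup (Fin 2) ℂ) := connectedSpace_specialUnitaryGroup
  set C : ℝ≥0∞ := ENNReal.ofReal (4 * (2 * Real.pi ^ 2)⁻¹) with hC
  have hC0 : C ≠ 0 := by
    rw [hC, Ne, ENNReal.ofReal_eq_zero, not_le]; positivity
  have hCtop : C ≠ ⊤ := ENNReal.ofReal_ne_top
  refine exists_nHit_mulWalk_minorised_of_density (continuous_su2TraceBump r) (fun U => su2TraceBump_nonneg r U)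
    (su2TraceBump_one_pos hr0 hrπ) (mul_ne_zero hc (ENNReal.inv_ne_zero.2 hCtop)) ?_
  calc (c * C⁻¹) • (haarProbability (Matrix.specialUnitaryGroup (Fin 2) ℂ)).withDensity
          (fun U => ENNReal.ofReal (su2TraceBump r U))
      = c • (C⁻¹ • (haarProbability (Matrix.specialUnitaryGroup (Fin 2) ℂ)).withDensity
          (fun U => ENNReal.ofReal (su2TraceBump r U))) := by rw [mul_smul]
    _ ≤ c • (C⁻¹ • (C • (volume.restrict (ball (0 : EuclideanSpace ℝ (Fin 3)) r)).map expPauli)) :=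
        measure_smul_le_smul_of_le (measure_smul_le_smul_of_le (withDensity_su2TraceBump_le hr0) _) _
    _ = c • (volume.restrict (ball (0 : EuclideanSpace ℝ (Fin 3)) r)).map expPauli := by
        rw [smul_smul, smul_smul, mul_assoc, ENNReal.inv_mul_cancel hC0 hCtop, mul_one]
    _ ≤ ν := hν

/-- **THE N-HIT `SU(2)` LINK METROPOLIS IS UNIFORMLY ERGODIC** for every inversion-invariant
probability step law dominating Lebesgue-through-the-chart near `1` and every measurable weight
pinched `0 < m ≤ p ≤ M`: there are `k` and `ε ∈ (0, 1]` with
`|μ₀(K^k)ᵗ(A) − (Z⁻¹p·Haar)(A)| ≤ (1 − ε)ᵗ` for every initial law, `K = symMH (mulWalk ν) p`, and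
`Z⁻¹ p · Haar` is the only probability law invariant under one hit. -/
theorem su2LinkMetropolis_uniformlyErgodic {ν : Measure (Matrix.specialUnitaryGroup (Fin 2) ℂ)}
    [IsProbabilityMeasure ν] [ν.IsInvInvariant] {r : ℝ} (hr0 : 0 < r) (hrπ : r ≤ Real.pi) {c : ℝ≥0∞}
    (hc : c ≠ 0) (hν : c • (volume.restrict (ball (0 : EuclideanSpace ℝ (Fin 3)) r)).map expPauli ≤ ν)
    {p : Matrix.specialUnitaryGroup (Fin 2) ℂ → ℝ} {m M : ℝ} (hp : Measurable p) (hm : 0 < m)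
    (hpm : ∀ x, m ≤ p x) (hpM : ∀ x, p x ≤ M) :
    ∃ k : ℕ, ∃ ε : ℝ, 0 < ε ∧ ε ≤ 1 ∧
      (∀ (μ₀ : Measure (Matrix.specialUnitaryGroup (Fin 2) ℂ)) [IsProbabilityMeasure μ₀] (t : ℕ)
          (A : Set (Matrix.specialUnitaryGroup (Fin 2) ℂ)),
        |((fun m' : Measure (Matrix.specialUnitaryGroup (Fin 2) ℂ) => m'.bind (nHit (symMH (mulWalk ν) p) k))^[t] μ₀).real A
            - (gibbsProbability (haarProbability (Matrix.specialUnitaryGroup (Fin 2) ℂ)) p).real A| ≤ (1 - ε) ^ t) ∧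
      ∀ (π' : Measure (Matrix.specialUnitaryGroup (Fin 2) ℂ)) [IsProbabilityMeasure π'],
        Kernel.Invariant (symMH (mulWalk ν) p) π' →
          π' = gibbsProbability (haarProbability (Matrix.specialUnitaryGroup (Fin 2) ℂ)) p := by
  obtain ⟨k, δ, hδ, hcov⟩ := su2Kick_nHit_minorised hr0 hrπ hc hν
  haveI := isMarkovKernel_nHit_symMH_mulWalk (ν := ν) hp k
  set ε : ℝ≥0∞ := ENNReal.ofReal (m / M) ^ k * δ
  have hε0 : 0 < ε := groupLinkMetropolis_const_pos hδ hm hpm hpM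
  have hε1 : ε ≤ 1 := by
    have h := Measure.le_iff'.1 (groupLinkMetropolis_nHit_minorised hcov hp hm hpm hpM 1) univ
    rwa [Measure.smul_apply, smul_eq_mul, measure_univ, measure_univ, mul_one] at h
  have hεtop : ε ≠ ⊤ := ne_top_of_le_ne_top ENNReal.one_ne_top hε1
  refine ⟨k, ε.toReal, ENNReal.toReal_pos hε0.ne' hεtop,
    ENNReal.toReal_le_of_le_ofReal zero_le_one (by rwa [ENNReal.ofReal_one]), fun μ₀ _ t A => ?_,
    fun π' _ hπ' => ?_⟩
  · exact groupLinkMetropolis_nHit_uniformlyErgodic hcov hp hm hpm hpM μ₀ t A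
  · exact groupLinkMetropolis_invariant_unique hcov hδ hp hm hpm hpM hπ'

end Summit.Ventures.LatticeQCDFlow.Exactness
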